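import Summits.MatrixMultiplication.MatrixMultiplication.Theses.StrassenDefect
import Summits.MatrixMultiplication.MatrixMultiplication.Theorems.StrassenDefectDefectInequality
import Literature.Computability.AlgebraicComplexity.RectangularExponentAlpha
import Literature.Computability.AlgebraicComplexity.GroupAlgebraTensor
import Literature.Combinatorics.Additive.TripleProductProperty

/-!
# VanishingStrassenDefect — STRATEGY CENSUS, typed companion (crux-strategist, 2026-08-17)

Crux `stmt-MatrixMultiplication-4072` (`VanishingStrassenDefect`, "X") of route
`MatrixMultiplication/StrassenDefect` was re-audited RESTATED (at least summit-strength).  This file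
is the TYPED companion of `STRATEGY-CENSUS.md` in the same crux directory: it records, as Lean
`Prop`s that elaborate, every candidate piece of every decomposition `X₁ ∧ … ∧ X_k → X` that was
tried, and PROVES the cheap structural facts the census relies on:

* `vanishingStrassenDefect_iff_omegaBudgetDefect` — **the `N²` in X is cosmetic**: X is equivalent
  (sorry-free, from the landed `DefectInequality_proof`) to its `N^ω`-budget form
  `OmegaBudgetDefect` (junk `R̃(J) ≤ ε·m²·N^ω`).  Consequence used throughout the census: any piece
  that produces `⟨mN⟩` from `m² ⊙ ⟨N⟩` plus junk KNOWN to be a degeneration of `(ε m²) ⊙ ⟨N,N,N⟩`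
  already implies `ω = 2`, hence X — it is not a piece, it is X again.
* `vanishingStrassenDefect_of_priceDecay` — the route header's foreseen layer-2 node
  `PriceDecay` (a LinearDefect family, price `≤ C/m`) implies X ON ITS OWN (violates (a): a second
  piece would be decorative).
* `vanishingStrassenDefect_of_twoScaleOuter` — in a two-scale factorisation
  `m²⊙⟨N⟩ ⊴… r⊙⟨dN⟩-blocks ⊴… ⟨mN⟩` the outer piece is literally an instance family of X
  (violates (c)).

The remaining candidates (`ThinJunkSelfReduction`/`AlphaHalf`, `UpperHalf`/`LowerHalf` through an
intermediate tensor family, `MultiCopyDefect`, `HeisenbergAbelianization`, `ThresholdTPP` /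
`AbelianizationOverMatrices`) are recorded as definitions only; WHY each fails (a)/(b)/(c) is a
known-mathematics argument written out in `STRATEGY-CENSUS.md` (§Decomposition D1–D9), not a
cheap probe.  Nothing here is a route item; nothing is proposed to `Theorems/`.
-/

set_option linter.dupNamespace false
set_option linter.unusedVariables false

noncomputable section

open Literature.Computability.AlgebraicComplexity
open Literature.Barriers.MatrixMultiplication
open Summit.MatrixMultiplication.MatrixMultiplication.Theses.StrassenDefect

namespace Summit.MatrixMultiplication.MatrixMultiplication.Cruxes.VanishingStrassenDefect.StrategyCensus

/-! ## The self-reduction relation -/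

/-- `SelfReduces m N J`: the big product `⟨mN,mN,mN⟩` is a degeneration of
`(m² ⊙ ⟨N,N,N⟩) ⊕ J` — exactly the relation inside `VanishingStrassenDefect`. -/
def SelfReduces (m N : ℕ) {ι κ μ : Type} [Fintype ι] [Fintype κ] [Fintype μ]
    (J : ι → κ → μ → ℂ) : Prop :=
  PolyDegeneratesTo
    (directSumTensor (kroneckerTensor (unitTensor ℂ (m ^ 2)) (matMulTensor ℂ N N N)) J)
    (matMulTensor ℂ (m * N) (m * N) (m * N))

/-- X, restated through `SelfReduces` (definitionally the route decl). -/
theorem vanishingStrassenDefect_iff :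
    VanishingStrassenDefect ↔
      ∀ ε : ℝ, 0 < ε → ∃ m N a b c : ℕ, 2 ≤ m ∧ 1 ≤ N ∧ ∃ J : Fin a → Fin b → Fin c → ℂ,
        SelfReduces m N J ∧ asymptoticRank J ≤ ε * ((m : ℝ) ^ 2 * (N : ℝ) ^ 2) :=
  Iff.rfl

/-! ## D1 · The `N^ω`-budget form (the `N²` is cosmetic) -/

/-- `X_ω`: as X but with junk budget `ε · m² · N^ω` instead of `ε · m² · N²`.  A priori WEAKER
than X (`N² ≤ N^ω`); in fact EQUIVALENT (`vanishingStrassenDefect_iff_omegaBudgetDefect`). -/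
def OmegaBudgetDefect : Prop :=
  ∀ ε : ℝ, 0 < ε → ∃ m N a b c : ℕ, 2 ≤ m ∧ 1 ≤ N ∧ ∃ J : Fin a → Fin b → Fin c → ℂ,
    SelfReduces m N J ∧ asymptoticRank J ≤ ε * ((m : ℝ) ^ 2 * (N : ℝ) ^ omega ℂ)

/-- `X → X_ω` (`N² ≤ N^ω` since `ω ≥ 2`, `N ≥ 1`). -/
theorem omegaBudgetDefect_of_vanishingStrassenDefect (hX : VanishingStrassenDefect) :
    OmegaBudgetDefect := by
  intro ε hε
  obtain ⟨m, N, a, b, c, hm, hN, J, hdeg, hJ⟩ := hX ε hε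
  refine ⟨m, N, a, b, c, hm, hN, J, hdeg, hJ.trans ?_⟩
  have h2 : (2 : ℝ) ≤ omega ℂ := omega_two_le ℂ
  have hN1 : (1 : ℝ) ≤ N := by exact_mod_cast hN
  have hNsq : (N : ℝ) ^ 2 ≤ (N : ℝ) ^ omega ℂ := by
    calc (N : ℝ) ^ 2 = (N : ℝ) ^ ((2 : ℕ) : ℝ) := (Real.rpow_natCast _ 2).symm
      _ ≤ (N : ℝ) ^ omega ℂ := Real.rpow_le_rpow_of_exponent_le hN1 (by push_cast; exact h2)
  exact mul_le_mul_of_nonneg_left (mul_le_mul_of_nonneg_left hNsq (sq_nonneg _)) hε.le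

/-- `X_ω → ω(ℂ) = 2`: the deciding argument of the route (`closes`) never used the `N²`; with the
landed `DefectInequality_proof`, `(mN)^ω ≤ m² N^ω + ε m² N^ω` gives `m^ω ≤ (1+ε) m²`. -/
theorem matrixMultiplication_of_omegaBudgetDefect (hX : OmegaBudgetDefect) :
    _root_.MatrixMultiplication := by
  show omega ℂ = 2
  have hD : DefectInequality :=
    Summit.MatrixMultiplication.MatrixMultiplication.Theorems.DefectInequality_proof
  have h2 : (2 : ℝ) ≤ omega ℂ := omega_two_le ℂ
  refine le_antisymm ?_ h2
  refine le_of_forall_pos_le_add fun δ hδ => ?_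
  have hlog2 : (0 : ℝ) < Real.log 2 := Real.log_pos one_lt_two
  have hε : (0 : ℝ) < δ * Real.log 2 := mul_pos hδ hlog2
  obtain ⟨m, N, a, b, c, hm, hN, J, hdeg, hJ⟩ := hX (δ * Real.log 2) hε
  have hineq := hD m N a b c (le_trans one_le_two hm) hN J hdeg
  have hm2 : (2 : ℝ) ≤ m := by exact_mod_cast hm
  have hm0 : (0 : ℝ) < m := by linarith
  have hN1 : (1 : ℝ) ≤ N := by exact_mod_cast hN
  have hN0 : (0 : ℝ) < N := by linarith
  have hNω : (0 : ℝ) < (N : ℝ) ^ omega ℂ := Real.rpow_pos_of_pos hN0 _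
  have key : (m : ℝ) ^ omega ℂ * (N : ℝ) ^ omega ℂ ≤
      ((1 + δ * Real.log 2) * (m : ℝ) ^ 2) * (N : ℝ) ^ omega ℂ := by
    calc (m : ℝ) ^ omega ℂ * (N : ℝ) ^ omega ℂ
          = ((m : ℝ) * N) ^ omega ℂ := (Real.mul_rpow hm0.le hN0.le).symm
      _ ≤ (m : ℝ) ^ 2 * (N : ℝ) ^ omega ℂ + asymptoticRank J := hineq
      _ ≤ (m : ℝ) ^ 2 * (N : ℝ) ^ omega ℂ +
            δ * Real.log 2 * ((m : ℝ) ^ 2 * (N : ℝ) ^ omega ℂ) := by linarith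
      _ = ((1 + δ * Real.log 2) * (m : ℝ) ^ 2) * (N : ℝ) ^ omega ℂ := by ring
  have key2 : (m : ℝ) ^ omega ℂ ≤ (1 + δ * Real.log 2) * (m : ℝ) ^ 2 :=
    le_of_mul_le_mul_right key hNω
  have hlogm : Real.log 2 ≤ Real.log m := Real.log_le_log two_pos hm2
  have hlogm0 : (0 : ℝ) < Real.log m := lt_of_lt_of_le hlog2 hlogm
  have hlog1 : Real.log (1 + δ * Real.log 2) ≤ δ * Real.log 2 := by
    rw [Real.log_le_iff_le_exp (by positivity)]
    linarith [Real.add_one_le_exp (δ * Real.log 2)]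
  have hlogkey := Real.log_le_log (Real.rpow_pos_of_pos hm0 _) key2
  rw [Real.log_rpow hm0, Real.log_mul (by positivity) (by positivity), Real.log_pow] at hlogkey
  push_cast at hlogkey
  have hδm : δ * Real.log 2 ≤ δ * Real.log m := mul_le_mul_of_nonneg_left hlogm hδ.le
  by_contra hcon
  have hlt : 2 + δ < omega ℂ := lt_of_not_ge hcon
  have hpos : (0 : ℝ) < (omega ℂ - 2 - δ) * Real.log m := mul_pos (by linarith) hlogm0
  nlinarith

/-- `X_ω → X`: by the previous theorem `ω = 2`, so the `N^ω` in the budget IS `N²`. -/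
theorem vanishingStrassenDefect_of_omegaBudgetDefect (hX : OmegaBudgetDefect) :
    VanishingStrassenDefect := by
  have hω : omega ℂ = 2 := matrixMultiplication_of_omegaBudgetDefect hX
  intro ε hε
  obtain ⟨m, N, a, b, c, hm, hN, J, hdeg, hJ⟩ := hX ε hε
  refine ⟨m, N, a, b, c, hm, hN, J, hdeg, ?_⟩
  have e : (N : ℝ) ^ omega ℂ = (N : ℝ) ^ 2 := by rw [hω, Real.rpow_two]
  rwa [e] at hJ

/-- **`X ↔ X_ω`**: the `N²`-accounting of the deciding crux is cosmetic. -/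
theorem vanishingStrassenDefect_iff_omegaBudgetDefect :
    VanishingStrassenDefect ↔ OmegaBudgetDefect :=
  ⟨omegaBudgetDefect_of_vanishingStrassenDefect, vanishingStrassenDefect_of_omegaBudgetDefect⟩

/-! ## D2 · PriceDecay (route header, "TWO-LAYER PLAN") — a single piece that already implies X -/

/-- `PriceDecay`: a LinearDefect FAMILY — for some constant `C`, every scale ratio `m ≥ 2` admits a
self-reduction with junk `R̃(J) ≤ C · m · N²` (price `C/m` per block). -/
def PriceDecay : Prop :=
  ∃ C : ℝ, ∀ m : ℕ, 2 ≤ m → ∃ N a b c : ℕ, 1 ≤ N ∧ ∃ J : Fin a → Fin b → Fin c → ℂ,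
    SelfReduces m N J ∧ asymptoticRank J ≤ C * ((m : ℝ) * (N : ℝ) ^ 2)

/-- `PriceDecay → X` (pure bookkeeping: take `m ≥ C/ε`).  Hence `PriceDecay` cannot be one of
`k ≥ 2` load-bearing pieces: whatever is conjoined with it is decorative (violates (a)). -/
theorem vanishingStrassenDefect_of_priceDecay (h : PriceDecay) : VanishingStrassenDefect := by
  obtain ⟨C, hC⟩ := h
  intro ε hε
  obtain ⟨m, hm2, hmC⟩ : ∃ m : ℕ, 2 ≤ m ∧ C ≤ ε * m := by
    refine ⟨max 2 ⌈C / ε⌉₊, le_max_left _ _, ?_⟩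
    have h1 : C / ε ≤ ⌈C / ε⌉₊ := Nat.le_ceil _
    have h2 : ((⌈C / ε⌉₊ : ℕ) : ℝ) ≤ ((max 2 ⌈C / ε⌉₊ : ℕ) : ℝ) := by
      exact_mod_cast le_max_right _ _
    have h3 : C / ε ≤ ((max 2 ⌈C / ε⌉₊ : ℕ) : ℝ) := h1.trans h2
    rw [div_le_iff₀ hε] at h3
    linarith [mul_comm (((max 2 ⌈C / ε⌉₊ : ℕ) : ℝ)) ε]
  obtain ⟨N, a, b, c, hN, J, hdeg, hJ⟩ := hC m hm2
  refine ⟨m, N, a, b, c, hm2, hN, J, hdeg, hJ.trans ?_⟩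
  have hm0 : (0 : ℝ) ≤ m := Nat.cast_nonneg _
  have hN0 : (0 : ℝ) ≤ (N : ℝ) ^ 2 := sq_nonneg _
  calc C * ((m : ℝ) * (N : ℝ) ^ 2) ≤ (ε * m) * ((m : ℝ) * (N : ℝ) ^ 2) :=
        mul_le_mul_of_nonneg_right hmC (mul_nonneg hm0 hN0)
    _ = ε * ((m : ℝ) ^ 2 * (N : ℝ) ^ 2) := by ring

/-! ## D3 · Two-scale factorisation `m²⊙⟨N⟩ ⇝ (m/d')²-many ⟨d'N⟩ ⇝ ⟨mN⟩` -/

/-- Outer piece of a two-scale split: `⟨m·(dN)⟩` from `m²` blocks `⟨dN⟩` plus vanishing junk.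
This is an INSTANCE FAMILY of X itself (block size restricted to multiples `d·N`). -/
def TwoScaleOuter : Prop :=
  ∀ ε : ℝ, 0 < ε → ∃ m d N a b c : ℕ, 2 ≤ m ∧ 1 ≤ d ∧ 1 ≤ N ∧ ∃ J : Fin a → Fin b → Fin c → ℂ,
    SelfReduces m (d * N) J ∧ asymptoticRank J ≤ ε * ((m : ℝ) ^ 2 * ((d * N : ℕ) : ℝ) ^ 2)

/-- Inner piece of a two-scale split: the `m²` intermediate blocks `⟨dN⟩` from `(md)²` blocks `⟨N⟩`
plus vanishing junk — a MULTI-COPY vanishing defect at scale ratio `d` (weaker than X, still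
summit-tied: it gives `d^ω ≤ (1+ε) d²` through the same calculus). -/
def TwoScaleInner : Prop :=
  ∀ ε : ℝ, 0 < ε → ∃ m d N a b c : ℕ, 2 ≤ m ∧ 2 ≤ d ∧ 1 ≤ N ∧ ∃ J : Fin a → Fin b → Fin c → ℂ,
    PolyDegeneratesTo
      (directSumTensor (kroneckerTensor (unitTensor ℂ ((m * d) ^ 2)) (matMulTensor ℂ N N N)) J)
      (kroneckerTensor (unitTensor ℂ (m ^ 2)) (matMulTensor ℂ (d * N) (d * N) (d * N))) ∧
    asymptoticRank J ≤ ε * (((m * d : ℕ) : ℝ) ^ 2 * (N : ℝ) ^ 2)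

/-- `TwoScaleOuter → X` by instantiation (`N := d·N`): the outer piece IS X (violates (c)). -/
theorem vanishingStrassenDefect_of_twoScaleOuter (h : TwoScaleOuter) : VanishingStrassenDefect := by
  intro ε hε
  obtain ⟨m, d, N, a, b, c, hm, hd, hN, J, hdeg, hJ⟩ := h ε hε
  exact ⟨m, d * N, a, b, c, hm,
    Nat.one_le_iff_ne_zero.2 (Nat.mul_ne_zero (by omega) (by omega)), J, hdeg, hJ⟩

/-! ## D4 · Rectangular-junk split: `ω = ω(1,½,1)` ∧ `ω(1,½,1) = 2` -/

/-- The three orientations of the square-root-thin product at size `P`: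
`⟨P²,P,P²⟩ ⊕ ⟨P,P²,P²⟩ ⊕ ⟨P²,P²,P⟩` (each of max flattening rank `P⁴`, asymptotic rank
`P^{ω(2,1,2)} = P^{2·ω(1,½,1)}`). -/
def thinJunk (P : ℕ) :=
  directSumTensor (matMulTensor ℂ (P ^ 2) P (P ^ 2))
    (directSumTensor (matMulTensor ℂ P (P ^ 2) (P ^ 2)) (matMulTensor ℂ (P ^ 2) (P ^ 2) P))

/-- `X₁(½)`: a self-reduction whose junk is `k` copies of the thin products `thinJunk P`, budgeted
at their OPTIMISTIC (flattening) cost `3·k·P⁴ ≤ ε·m²·N²`.  Border-rank slack of a factor `P` per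
block, "border-expensive yet (conjecturally) asymptotically cheap" junk. -/
def ThinJunkSelfReduction : Prop :=
  ∀ ε : ℝ, 0 < ε → ∃ m N k P : ℕ, 2 ≤ m ∧ 1 ≤ N ∧ 2 ≤ P ∧
    3 * (k : ℝ) * (P : ℝ) ^ 4 ≤ ε * ((m : ℝ) ^ 2 * (N : ℝ) ^ 2) ∧
    SelfReduces m N (kroneckerTensor (unitTensor ℂ k) (thinJunk P))

/-- `X₂(½)`: the dual-exponent milestone `ω(1, ½, 1) = 2`, i.e. `α ≥ ½`
(`omegaRect_eq_two_iff_le_dualExponentAlpha`); record `α ≥ 0.321334` (VXXZ 2024). -/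
def AlphaHalf : Prop := omegaRect ℂ 1 (1 / 2 : ℝ) 1 = 2

/-- COLLAPSE of D4 (proved in STRATEGY-CENSUS.md §D4, not here): `X₁(½)` ALONE gives
`ω ≤ ω(1,½,1)` (DefectInequality in `N^ω`-currency with `R̃(⟨P²,P,P²⟩) = P^{2ω(1,½,1)}`,
`asymptoticRank_matMulTensor_rect` + `omegaRect_smul`), and the trivial block algorithm
`ω(1,½,1) ≤ 2 + (ω−2)/2` then forces `ω = 2`.  So `X₁(½) → S → AlphaHalf`, the second piece is
decorative, and `X₁(½)` is at least X: (a) and (c) fail. The same happens for every aspect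
exponent `a < 1` (`ω(1,a,1) ≤ 2 + a(ω−2)`), and for every matrix-product-SHAPED junk class. -/
def ThinJunkCollapse : Prop := ThinJunkSelfReduction → _root_.MatrixMultiplication

/-! ## D5 · Factorisation through an intermediate tensor family `T_m` of cubic format `m²` -/

/-- Upper half of a factorisation through `T`: `⟨mN⟩ ⊴ (T_m ⊗ ⟨N⟩) ⊕ J`, `R̃(J) ≤ ε m² N²`. -/
def UpperHalf (T : (m : ℕ) → Fin (m ^ 2) → Fin (m ^ 2) → Fin (m ^ 2) → ℂ) : Prop :=
  ∀ ε : ℝ, 0 < ε → ∃ m N a b c : ℕ, 2 ≤ m ∧ 1 ≤ N ∧ ∃ J : Fin a → Fin b → Fin c → ℂ,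
    PolyDegeneratesTo (directSumTensor (kroneckerTensor (T m) (matMulTensor ℂ N N N)) J)
      (matMulTensor ℂ (m * N) (m * N) (m * N)) ∧
    asymptoticRank J ≤ ε * ((m : ℝ) ^ 2 * (N : ℝ) ^ 2)

/-- Lower half of a factorisation through `T`: `T_m ⊗ ⟨N⟩ ⊴ (m² ⊙ ⟨N⟩) ⊕ J'`, `R̃(J') ≤ ε m² N²`,
uniformly in `(m, N)` so that it composes with `UpperHalf T` (prices add: `ε/2 + ε/2`). -/
def LowerHalf (T : (m : ℕ) → Fin (m ^ 2) → Fin (m ^ 2) → Fin (m ^ 2) → ℂ) : Prop :=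
  ∀ ε : ℝ, 0 < ε → ∀ m N : ℕ, 2 ≤ m → 1 ≤ N → ∃ a b c : ℕ, ∃ J : Fin a → Fin b → Fin c → ℂ,
    PolyDegeneratesTo
      (directSumTensor (kroneckerTensor (unitTensor ℂ (m ^ 2)) (matMulTensor ℂ N N N)) J)
      (kroneckerTensor (T m) (matMulTensor ℂ N N N)) ∧
    asymptoticRank J ≤ ε * ((m : ℝ) ^ 2 * (N : ℝ) ^ 2)

/-! ## D6 · Multi-copy (amortised) defect — weaker than X, still decides the summit, but no way back to one copy -/

/-- `X^mult`: `t` copies of `⟨mN⟩` from `t·m²` blocks `⟨N⟩` plus junk of price `→ 0` per block. -/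
def MultiCopyDefect : Prop :=
  ∀ ε : ℝ, 0 < ε → ∃ t m N a b c : ℕ, 1 ≤ t ∧ 2 ≤ m ∧ 1 ≤ N ∧ ∃ J : Fin a → Fin b → Fin c → ℂ,
    PolyDegeneratesTo
      (directSumTensor (kroneckerTensor (unitTensor ℂ (t * m ^ 2)) (matMulTensor ℂ N N N)) J)
      (kroneckerTensor (unitTensor ℂ t) (matMulTensor ℂ (m * N) (m * N) (m * N))) ∧
    asymptoticRank J ≤ ε * ((t : ℝ) * (m : ℝ) ^ 2 * (N : ℝ) ^ 2)

/-! ## D7 · Heisenberg abelianisation over matrix coefficients (the cocycle dictionary made literal) -/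

/-- Multiplication table of the Heisenberg group `H_p = U₃(ℤ/p)` on `(Fin p)³`,
`(a,b,c)·(a',b',c') = (a+a', b+b', c+c'+ab')` (as in route `ModularHeisenberg`). -/
def heisenbergTensor (p : ℕ) :
    Fin p × Fin p × Fin p → Fin p × Fin p × Fin p → Fin p × Fin p × Fin p → ℂ :=
  fun z x y =>
    if x.1 + y.1 = z.1 ∧ x.2.1 + y.2.1 = z.2.1 ∧ x.2.2 + y.2.2 + x.1 * y.2.1 = z.2.2 then 1 else 0

/-- `ℂ[H_p] ⊗ M_N ⊴ (p³ ⊙ ⟨N⟩) ⊕ J` with `R̃(J) ≤ ε p³ N²`: "abelianising the Heisenberg group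
algebra is cheap over matrix coefficients".  Since `ℂ[H_p] ≅ ℂ^{p²} ⊕ (p−1)·M_p`, this is a
`(p−1)`-COPY vanishing defect at scale ratio `p` — it decides `ω = 2` (even with ε fixed), is
weaker than X, and is NOT a piece of X (single copy unreachable: D6). -/
def HeisenbergAbelianization : Prop :=
  ∀ ε : ℝ, 0 < ε → ∃ p N a b c : ℕ, Nat.Prime p ∧ 1 ≤ N ∧ ∃ J : Fin a → Fin b → Fin c → ℂ,
    PolyDegeneratesTo
      (directSumTensor (kroneckerTensor (unitTensor ℂ (p ^ 3)) (matMulTensor ℂ N N N)) J)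
      (kroneckerTensor (heisenbergTensor p) (matMulTensor ℂ N N N)) ∧
    asymptoticRank J ≤ ε * ((p : ℝ) ^ 3 * (N : ℝ) ^ 2)

/-! ## D8 · Group-theoretic factorisation: TPP at the square-root threshold ∧ abelianisation over M_N -/

/-- `ThresholdTPP`: TPP triples of size `n × n × n` in groups of order `≤ (1+ε) n²`, `n → ∞`. -/
def ThresholdTPP : Prop :=
  ∀ ε : ℝ, 0 < ε → ∀ n₀ : ℕ, ∃ (G : Type) (_ : Group G) (_ : Fintype G) (_ : DecidableEq G)
    (S T U : Finset G), Literature.Combinatorics.Additive.TripleProductProperty S T U ∧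
      n₀ ≤ S.card ∧ T.card = S.card ∧ U.card = S.card ∧
      (Fintype.card G : ℝ) ≤ (1 + ε) * (S.card : ℝ) ^ 2

/-- `AbelianizationOverMatrices`: for every finite group, the group tensor over `M_N` degenerates
from `|G|` independent blocks `⟨N⟩` plus junk of vanishing price (for some `N`). -/
def AbelianizationOverMatrices : Prop :=
  ∀ ε : ℝ, 0 < ε → ∀ (G : Type) [Group G] [Fintype G] [DecidableEq G],
    ∃ N a b c : ℕ, 1 ≤ N ∧ ∃ J : Fin a → Fin b → Fin c → ℂ,
      PolyDegeneratesTo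
        (directSumTensor (kroneckerTensor (unitTensor ℂ (Fintype.card G)) (matMulTensor ℂ N N N)) J)
        (kroneckerTensor (groupTensor ℂ G) (matMulTensor ℂ N N N)) ∧
      asymptoticRank J ≤ ε * ((Fintype.card G : ℝ) * (N : ℝ) ^ 2)

end Summit.MatrixMultiplication.MatrixMultiplication.Cruxes.VanishingStrassenDefect.StrategyCensus

end
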